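import Summits.BirchSwinnertonDyer.BirchSwinnertonDyer.Theorems.ManinLocalTwoThreeCDivisionAssembly
import Summits.BirchSwinnertonDyer.BirchSwinnertonDyer.Theorems.ManinLocalTwoThreeCDivisionUDCConsumers
import HarnessLib

/-!
# C2's residual is ODD-SQUAREFREE: `|c₀| = 1` at every level with an odd additive prime, modulo CDT only; and
# C2 `ManinOddAtFour` ⟸ CDT ∧ E-an-152c (index `4` excluded at `N = 2^a·m`, `m` odd squarefree); C5 `ManinPrimeToAdditiveFiveLe` ⟸ CDT
# (cell bsd-f2-manin, route `ManinLocalTwoThree`, crux C2 stmt-BirchSwinnertonDyer-22967; lead p1 gen 19 — def-free landing of an g45's E-an-152c architecture)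

With the `c`-division witness PROVED for every `X₀(N)`-datum (p3 g18 `CDivAssembly.exists_cDivisionWitness`, nodes by p2 g20 / p3 g18) and Unbounded
Denominators (CDT, printed), LEAD's `Γ₁`-Wohlfahrt kernel gives `Λ₁(f) ⊆ Λ_W = c₀·Λ₀(f)` for every lattice-optimal datum
(`CDivisionUDC.periodLatticeGamma1_le_neron_of_cDivisionWitness_of_UDW`).  If an ODD prime `p` has `p² ∣ N` then `a_p = 0` (Atkin–Lehner) and
`p·Λ₀(f) ⊆ Λ₁(f)` (Ling–Oesterlé, tree `pMulLatticeLeGamma1OfTracelessPrime_holds`), so `p·Λ₀ ⊆ c₀·Λ₀`: `c₀ ∣ p`, and `|c₀| = p` would make `Λ₁ = pΛ₀`, which never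
occurs for `p ≥ 3` (tree `not_periodLatticeGamma1_eq_natCast_mul_periodLattice`).  Hence (§1) **`|c₀| = 1` at every such level, modulo CDT only** (an g45,
`abs_maninConstant_eq_one_of_CDT_cDivisionWitnessLaw_of_odd_sq_dvd`, here def-free), in particular `2 ∤ c₀` there; and (§2) **C2 ⟸ CDT ∧ E-an-152c**, where
E-an-152c `ShimuraIndexNeFourAtFourOddSquarefree` (an g45, body verbatim as a hypothesis) is E-an-152b restricted to the levels `N = 2^a·m`, `m` odd squarefree —
the TRUE residual of C2 (and of the whole route at `2`); and (§3) **C5 `ManinPrimeToAdditiveFiveLe` (stmt-…-22969: `p ≥ 5`, `p² ∣ N ⟹ p ∤ c₀`) ⟸ CDT**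
by §1, plus `c₀ ∣ 2`-type bound `|c₀| ≤ 2` at `4 ∣ N` ⟸ CDT.  HONEST FRAMING: CONDITIONAL on the printed CDT fact and (§2) on E-an-152c, OPEN exactly at the
one-additive-prime levels of cuspidal-inertia `2`-rank `≥ 2` (the index-`4` world); C2, Manin's conjecture and BSD are NOT proved by this file.  No definitions, no sorry.
[cite: CalegariDimitrovTang2025, Thm. 1.0.1 and Remarks 58–59] [cite: LingOesterle1991, Thm. 6] [cite: AtkinLehner1970, Thm. 3] [cite: Stevens1989, §2]
-/

set_option autoImplicit false
-- lint-debt: the directory name repeats the summit name (sibling precedent `ManinLocalTwoThreeCDivisionAssembly.lean`)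
set_option linter.dupNamespace false

noncomputable section

open scoped MatrixGroups ModularForm Manifold
open CongruenceSubgroup
open WeierstrassCurve Literature.NumberTheory.EllipticCurves Literature.NumberTheory.EllipticCurves.ModularForms
open Literature.NumberTheory.Automorphic
open Summit.BirchSwinnertonDyer.Rank1Residual.ManinAdditive.UDCKummerLineK
open Summit.BirchSwinnertonDyer.Rank1Residual.ManinAdditive.ShimuraKernel

namespace Summit.BirchSwinnertonDyer.BirchSwinnertonDyer.Theorems.ManinLocalTwoThree.CDivisionUDC

variable {W : WeierstrassCurve ℚ} [W.IsElliptic] [W.IsGloballyMinimal] {N : ℕ} [NeZero N]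

/-! ## §1 `|c₀| = 1` at every level with an odd additive prime, modulo CDT -/

/-- **`Λ₁(f) ⊆ Λ_W` for every `X₀(N)`-datum, modulo CDT** (an g45's E-an-250 `Gamma1PeriodsInNeronLattice`, «Stevens I strong», here def-free): the
`c`-division witness (PROVED, `CDivAssembly.exists_cDivisionWitness`) + Unbounded Denominators + the `Γ₁`-Wohlfahrt kernel.
[cite: CalegariDimitrovTang2025, Thm. 1.0.1 and Remarks 58–59] [cite: Wohlfahrt1964, Thm. 2] -/
theorem periodLatticeGamma1_le_neron_of_CDT
    (hCDT : Literature.NumberTheory.Automorphic.CalegariDimitrovTang2025_unboundedDenominators_algInt) (D : ModularParametrizationData W N) :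
    ∀ z ∈ periodLatticeGamma1 D.f, z ∈ D.L.lattice := by
  obtain ⟨k, F, hhol, hinv, hstab, hgrowth, hq⟩ := CDivAssembly.exists_cDivisionWitness W D
  exact periodLatticeGamma1_le_neron_of_cDivisionWitness_of_UDW D (UDWOfCDT.unboundedDenominatorsWeightAlgInt_of_CDT_algInt hCDT k)
    hhol hinv hstab hgrowth hq

/-- **`|c₀| = 1` whenever an odd `p² ∣ N`, modulo CDT** (lattice-optimal `X₀(N)`-datum of a globally minimal curve).  `pΛ₀ ⊆ Λ₁ ⊆ Λ_W = c₀Λ₀` gives `c₀ ∣ p`;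
`|c₀| = p` would give `Λ₁ = pΛ₀`, impossible for `p ≥ 3`.  So Manin's conjecture holds, modulo the printed CDT fact, for EVERY optimal curve with an odd additive
prime — in particular C2 and C3 there.  CONDITIONAL on CDT; Manin's conjecture is not proved by this.
[cite: CalegariDimitrovTang2025, Thm. 1.0.1] [cite: LingOesterle1991, Thm. 6] [cite: AtkinLehner1970, Thm. 3] -/
theorem abs_maninConstant_eq_one_of_CDT_of_odd_sq_dvd
    (hCDT : Literature.NumberTheory.Automorphic.CalegariDimitrovTang2025_unboundedDenominators_algInt) (D : ModularParametrizationData W N)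
    (hopt : ∀ z ∈ D.L.lattice, ∃ w ∈ periodLattice D.f, z = D.c * w) {p : ℕ} (hp : p.Prime) (h3 : 3 ≤ p) (hpN : p ^ 2 ∣ N) :
    |D.maninConstant| = 1 := by
  have hle := periodLatticeGamma1_le_neron_of_CDT hCDT D
  have hc0 : D.c ≠ 0 := D.maninConstant_ne_zero_holds
  -- `p·Λ₀ ⊆ Λ₁` (traceless prime)
  have hpΛ : ∀ z ∈ periodLattice D.f, (p : ℂ) * z ∈ periodLatticeGamma1 D.f :=
    pMulLatticeLeGamma1OfTracelessPrime_holds N D.f D.isNewformOf.1 p hp ((dvd_pow_self p two_ne_zero).trans hpN)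
      (D.isNewformOf.1.cuspCoeff_eq_zero_of_sq_dvd hp hpN)
  -- `c₀ ∣ p`: `ω₁ = c₀ w₁`, `p w₁ ∈ Λ_W`, so `(p/c₀)·ω₁ ∈ Λ_W`
  obtain ⟨w₁, hw₁, e₁⟩ := hopt D.L.ω₁ D.L.ω₁_mem_lattice
  have hpw : (p : ℂ) * w₁ ∈ D.L.lattice := hle _ (hpΛ w₁ hw₁)
  have hcC : (D.c : ℂ) ≠ 0 := by exact_mod_cast hc0
  have hmem : ((((p : ℚ) / D.c : ℚ)) : ℂ) * D.L.ω₁ + ((0 : ℚ) : ℂ) * D.L.ω₂ ∈ D.L.lattice := by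
    have : ((((p : ℚ) / D.c : ℚ)) : ℂ) * D.L.ω₁ + ((0 : ℚ) : ℂ) * D.L.ω₂ = (p : ℂ) * w₁ := by
      push_cast
      rw [zero_mul, add_zero, div_mul_eq_mul_div, div_eq_iff hcC, e₁]; ring
    rw [this]; exact hpw
  have hden := (PeriodPair.mul_ω₁_add_mul_ω₂_mem_lattice (L := D.L) (α := (p : ℚ) / D.c) (β := 0)).mp hmem
  -- so `D.c ∣ p`
  have hdvd : D.c ∣ (p : ℤ) := by
    have hq : ((p : ℚ) / D.c) = ((((p : ℚ) / D.c).num : ℚ)) := by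
      conv_lhs => rw [← Rat.num_div_den ((p : ℚ) / D.c)]
      rw [hden.1]; simp
    refine ⟨((p : ℚ) / D.c).num, ?_⟩
    have hcQ : (D.c : ℚ) ≠ 0 := by exact_mod_cast hc0
    have : (p : ℚ) = (D.c : ℚ) * ((((p : ℚ) / D.c).num : ℤ) : ℚ) := by rw [← hq]; field_simp
    exact_mod_cast this
  -- `|c₀| ∈ {1, p}`
  have hnat : D.c.natAbs ∣ p := by
    have := Int.natAbs_dvd_natAbs.mpr hdvd
    simpa using this
  rcases (Nat.dvd_prime hp).mp hnat with h1 | hp'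
  · rw [Int.abs_eq_natAbs]; exact_mod_cast h1
  · -- `|c₀| = p`: then `Λ₁ = pΛ₀`, impossible
    exfalso
    refine not_periodLatticeGamma1_eq_natCast_mul_periodLattice D hopt h3 fun z ↦ ⟨fun hz ↦ ?_, ?_⟩
    · obtain ⟨w, hw, hzw⟩ := hopt z (hle z hz)
      rcases intCast_eq_natAbs_or D.c with hc | hc
      · exact ⟨w, hw, by rw [hzw, hc, hp']⟩
      · exact ⟨-w, neg_mem hw, by rw [hzw, hc, hp']; ring⟩
    · rintro ⟨w, hw, rfl⟩
      exact hpΛ w hw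

/-- **`2 ∤ c₀` at every level `4 ∣ N` with an odd additive prime, modulo CDT** — C2 on that locus, no law. [cite: CalegariDimitrovTang2025, Thm. 1.0.1] -/
theorem not_two_dvd_maninConstant_of_CDT_of_odd_sq_dvd
    (hCDT : Literature.NumberTheory.Automorphic.CalegariDimitrovTang2025_unboundedDenominators_algInt) (D : ModularParametrizationData W N)
    (hopt : ∀ z ∈ D.L.lattice, ∃ w ∈ periodLattice D.f, z = D.c * w) {p : ℕ} (hp : p.Prime) (h3 : 3 ≤ p) (hpN : p ^ 2 ∣ N) :
    ¬ (2 : ℤ) ∣ D.maninConstant := by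
  intro h2
  have h1 := abs_maninConstant_eq_one_of_CDT_of_odd_sq_dvd hCDT D hopt hp h3 hpN
  have : (2 : ℤ) ∣ |D.maninConstant| := (dvd_abs 2 D.maninConstant).mpr h2
  rw [h1] at this
  omega

/-! ## §2 C2 ⟸ CDT ∧ E-an-152c (the odd-squarefree residual) -/

/-- **C2 `ManinOddAtFour` ⟸ CDT ∧ E-an-152c `ShimuraIndexNeFourAtFourOddSquarefree`** (an g45's row, body verbatim as the hypothesis `hI4c`: index `4` excluded for
lattice-optimal data at `4 ∣ N` with NO odd square dividing `N`).  At levels with an odd `p² ∣ N`, §1 gives `2 ∤ c₀` outright; at the others the `c`-division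
witness + CDT give the index-`4` configuration from `2 ∣ c₀` (`CDivision.indexFour_of_cDivisionWitness_of_UDW`), excluded by `hI4c`.  The crux's four printed-fact
binders are unused.  CONDITIONAL on CDT (printed) and E-an-152c (OPEN: one-additive-prime levels of cuspidal-inertia `2`-rank `≥ 2`); C2, Manin's conjecture and BSD
are not proved by this. [cite: CalegariDimitrovTang2025, Thm. 1.0.1 and Remarks 58–59] [cite: LingOesterle1991, Thm. 6] [cite: Stevens1989, §2] -/
theorem maninOddAtFour_of_CDT_of_indexNeFourOddSquarefree
    (hCDT : Literature.NumberTheory.Automorphic.CalegariDimitrovTang2025_unboundedDenominators_algInt)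
    (hI4c : ∀ (W₀ : WeierstrassCurve ℚ) [W₀.IsElliptic] [W₀.IsGloballyMinimal] {N : ℕ} [NeZero N]
      (D₀ : ModularParametrizationData W₀ N),
      (∀ z ∈ D₀.L.lattice, ∃ w ∈ periodLattice D₀.f, z = D₀.c * w) → 2 ^ 2 ∣ N →
      (∀ p : ℕ, p.Prime → 3 ≤ p → ¬ p ^ 2 ∣ N) →
      ¬ (∀ z : ℂ, z ∈ periodLatticeGamma1 D₀.f ↔ ∃ w ∈ periodLattice D₀.f, z = 2 * w)) :
    Summit.BirchSwinnertonDyer.BirchSwinnertonDyer.Theses.ManinLocalTwoThree.ManinOddAtFour := by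
  intro _hM _hAU _hC _hnf W _ _ N _ D hopt h4
  by_cases hsq : ∃ p : ℕ, p.Prime ∧ 3 ≤ p ∧ p ^ 2 ∣ N
  · obtain ⟨p, hp, h3, hpN⟩ := hsq
    exact not_two_dvd_maninConstant_of_CDT_of_odd_sq_dvd hCDT D hopt hp h3 hpN
  · intro h2c
    simp only [not_exists, not_and] at hsq
    obtain ⟨k, F, hhol, hinv, hstab, hgrowth, hq⟩ := CDivAssembly.exists_cDivisionWitness W D
    exact hI4c W D hopt h4 (fun p hp h3 ↦ hsq p hp h3) (CDivision.indexFour_of_cDivisionWitness_of_UDW D hopt h4 h2c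
      (UDWOfCDT.unboundedDenominatorsWeightAlgInt_of_CDT_algInt hCDT k) hhol hinv hstab hgrowth hq)

/-- **E-an-152b ⟹ E-an-152c** (restriction to the odd-squarefree locus), so the new composition is at least as strong as the old one. [folklore] -/
theorem indexNeFourOddSquarefree_of_indexNeFour (h : ShimuraIndexNeFourAtFour) :
    ∀ (W₀ : WeierstrassCurve ℚ) [W₀.IsElliptic] [W₀.IsGloballyMinimal] {N : ℕ} [NeZero N]
      (D₀ : ModularParametrizationData W₀ N),
      (∀ z ∈ D₀.L.lattice, ∃ w ∈ periodLattice D₀.f, z = D₀.c * w) → 2 ^ 2 ∣ N →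
      (∀ p : ℕ, p.Prime → 3 ≤ p → ¬ p ^ 2 ∣ N) →
      ¬ (∀ z : ℂ, z ∈ periodLatticeGamma1 D₀.f ↔ ∃ w ∈ periodLattice D₀.f, z = 2 * w) :=
  fun W₀ _ _ _ _ D₀ hopt h4 _ ↦ h W₀ D₀ hopt h4

/-! ## §3 C5 `ManinPrimeToAdditiveFiveLe` ⟸ CDT, and `c₀ ∣ 2` at `4 ∣ N` ⟸ CDT -/

/-- **C5 `ManinPrimeToAdditiveFiveLe` (crux stmt-BirchSwinnertonDyer-22969) ⟸ CDT.**  For a lattice-optimal `X₀(N)`-datum and a prime `p ≥ 5` with `p² ∣ N`,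
§1 gives `|c₀| = 1`, so `p ∤ c₀`.  The crux's four printed-fact binders are unused.  CONDITIONAL on the printed CDT fact (statement-only in the tree);
C5, Manin's conjecture and BSD are not proved unconditionally by this. [cite: CalegariDimitrovTang2025, Thm. 1.0.1 and Remarks 58–59] [cite: LingOesterle1991, Thm. 6] -/
theorem maninPrimeToAdditiveFiveLe_of_CDT
    (hCDT : Literature.NumberTheory.Automorphic.CalegariDimitrovTang2025_unboundedDenominators_algInt) :
    Summit.BirchSwinnertonDyer.BirchSwinnertonDyer.Theses.ManinLocalTwoThree.ManinPrimeToAdditiveFiveLe := by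
  intro _hM _hAU _hC _hnf W _ _ N _ D hopt p hp h5 hpN hpc
  have h1 := abs_maninConstant_eq_one_of_CDT_of_odd_sq_dvd hCDT D hopt hp (by omega) hpN
  have hdvd : (p : ℤ) ∣ |D.maninConstant| := (dvd_abs (p : ℤ) D.maninConstant).mpr hpc
  rw [h1] at hdvd
  have hp1 : p ∣ 1 := by exact_mod_cast hdvd
  exact hp.ne_one (Nat.dvd_one.mp hp1)

/-- **`c₀ ∈ {±1, ±2}` at `4 ∣ N` ⟸ CDT** (hypothesis-free form of `natAbs_maninConstant_le_two_of_CDT_of_cDivisionWitnessLaw`, the witness being PROVED):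
the `4`-part and the odd part of Manin's conjecture at the additive prime `2`, modulo the printed CDT fact; the residual `|c₀| = 2` is the index-`4` world.
[cite: CalegariDimitrovTang2025, Thm. 1.0.1 and Remarks 58–59] [cite: LingOesterle1991, Thm. 6] -/
theorem natAbs_maninConstant_le_two_of_CDT
    (hCDT : Literature.NumberTheory.Automorphic.CalegariDimitrovTang2025_unboundedDenominators_algInt) (D : ModularParametrizationData W N)
    (h4 : 2 ^ 2 ∣ N) (hopt : ∀ z ∈ D.L.lattice, ∃ w ∈ periodLattice D.f, z = D.c * w) :
    D.maninConstant.natAbs ≤ 2 :=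
  natAbs_maninConstant_le_two_of_CDT_of_cDivisionWitnessLaw hCDT (fun W _ _ _ _ D ↦ CDivAssembly.exists_cDivisionWitness W D) D h4 hopt

end Summit.BirchSwinnertonDyer.BirchSwinnertonDyer.Theorems.ManinLocalTwoThree.CDivisionUDC

end
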